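import Summits.CriticalPhenomena.CardyFormulaZ2.Theorems.CardySusyWardWeakHolomorphyStaggeredFourDartFree
import Summits.CriticalPhenomena.CardyFormulaZ2.Theorems.CardySusyWardWeakHolomorphyStaggeredArrivalGlue
import Summits.CriticalPhenomena.CardyFormulaZ2.Theorems.CardySusyWardWeakHolomorphyStaggeredArrivalOfOnceLeft

/-!
# The crux `CardySusyWard.WeakHolomorphy` IS the weak, `∂φ`-tested, sublattice-staggered ARRIVAL law — and the staggered once-LEFT law

Line `Sketch` of the crux `CardySusyWard.WeakHolomorphy` (stmt-CriticalPhenomena-11292), lead c5 (infrastructure,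
`--supports`).  Composition of three landed facts:

* `weakHolomorphy_iff_weakKirchhoff` (lead c3, p146996): the crux ⟺ along every admissible family and for every test
  function, `δ^{5/3} Σ_p ∂φ(z_p)·K^s_p → 0`, `K^s_p = F(c_{p,1}) + F(c_{p,3}) − F(c_{p,0}) − F(c_{p,2})`
  (`F = bondDartObservable (Λ δ) δ (1/3)`, corners `c_{p,k} = medialCornersAt p.1 p.2 k` clockwise from `NW`);
* `stub_staggeredFourDartFree` (this seat's wave, p155223): the h/v-STAGGERED four-dart sum `s_p·Σ_k F(c_{p,k})` pairs to
  `o(δ^{-5/3})` with every smooth compactly supported weight along every eventually admissible mesh family — by the alias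
  corner identity it is the plain divergence of the spin-`−5/3` dart observable, which telescopes
  (`smoothDivergence_tendsto_zero_spin`); this is the dart form of the "staggered bisector pairing is vacuous" trap of
  `Cruxes/WeakHolomorphy/Disproof.lean` §C;
* `staggeredArrival_tendsto_iff_weakKirchhoff` (this seat's wave, p155735): given the free mode, per family and test function
  the weak Kirchhoff law ⟺ the staggered arrival law, because `K^s_p = 2·s_p·in_p − s_p·Σ_k F(c_{p,k})` with
  `s_p·in_p = F(c_{p,1}) + F(c_{p,3})` at a horizontal and `−(F(c_{p,0}) + F(c_{p,2}))` at a vertical medial vertex (the two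
  ARRIVING darts of the exploration at `z_p`).

* `staggeredOnceLeft_tendsto_iff_staggeredArrival` (this seat's second wave, p158303): given the free mode, per family and
  test function the staggered arrival law ⟺ the staggered once-LEFT law `δ^{5/3} Σ_p ∂φ(z_p)·s_p·Z_L(p) → 0`
  (`Z_L(p) = onceChiralObs (Λ δ) δ (1/3) z_p true`), by the node template `in = (2+λ²)Z_L + (2+λ̄²)Z_R` (p146994), the
  four-dart template `in + out = A_L Z_L + A_R Z_R` (p146994/p114738), the free mode, and `A_R ≠ 0`, `det = −2i ≠ 0`.

Hence `weakHolomorphy_iff_staggeredArrival` and `weakHolomorphy_iff_staggeredOnceLeft`: the crux holds iff, along every admissible square-lattice discretisation family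
of every Dobrushin domain and for every smooth compactly supported test function, `δ^{5/3} Σ_p ∂φ(z_p)·s_p·in_p → 0` — the
`∂φ`-tested, h/v-staggered ARRIVAL phase observable (all arrivals of the exploration at `z_p`, entry phases `e^{-iW/3}`) is
`o(δ^{1/3})` per vertex, weakly.  Relative to the v9 / weak-Kirchhoff normal forms this halves the unknowns (in-darts only,
no in/out comparison); by the node template (`inTemplateIdentity`, p146994: `in = (2+λ²)Z_L + (2+λ̄²)Z_R`) and the Kirchhoff
identity (`kirchhoffIdentity`, p114738: `in − out = κ_L Z_L + κ_R Z_R`), two linearly independent combinations, the open content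
is equivalently "the staggered once-visit chiral sum `Σ_p ∂φ(z_p) s_p Z_L(p)` is `o(δ^{-5/3})`" for ONE chirality (and then for
both, and for the first-arrival phase sum `2(Z_L + Z_R)`): no `e^{iπ/6}` datum and no left/right comparison remain in the
statement of what is open.  References: Duminil-Copin–Smirnov arXiv:1109.1549 §8.3 (Conj. 8.7); Duminil-Copin arXiv:1208.3787
Prop. 4; crux workfiles `Cruxes/WeakHolomorphy/{Disproof.lean §C–§D, STRATEGY-CENSUS.md §1, Lines/Sketch.lean (v11), Lines/Sketch.md}`.
-/

noncomputable section

namespace Summit.CriticalPhenomena.CardyFormulaZ2.Theorems.WeakHolomorphy.SplitBypass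

open scoped BigOperators Topology
open Filter Set MeasureTheory Complex
open _root_.Literature.Probability.LatticeModels
open _root_.Literature.Probability.RandomPlanarGeometry (DobrushinDomain)
open _root_.Literature.Barriers.CriticalPhenomena (medialCornersAt medialVertexOf)
open Summit.CriticalPhenomena.CardyFormulaZ2.Theorems.ParafermionPrecompact.Negative (IsFamily)

/-- **Per family: weak holomorphy of the vertex observable ⟺ the staggered arrival law.** Along an admissible family `Λ`
of the Dobrushin domain `D` and for a smooth test function `φ` compactly supported in the domain,
`δ^{5/3} Σ_z F_δ(z) ∂̄φ(z_δ) → 0` iff `δ^{5/3} Σ_p ∂φ(z_p)·s_p·in_p → 0`, `s_p·in_p` the sublattice-signed sum of the two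
arriving spin-`1/3` dart observables at `p` (`weakKirchhoff_tendsto_iff` ∘ `staggeredArrival_tendsto_iff_weakKirchhoff`, the
free mode supplied by `stub_staggeredFourDartFree`). [cite: DuminilCopinSmirnov2012Lattice, Conjecture 8.7] -/
theorem weakHolomorphy_tendsto_iff_staggeredArrival (D : DobrushinDomain) (Λ : ℝ → DiscreteDobrushin) (hΛ : IsFamily D Λ)
    (φ : ℂ → ℂ) (hφ : ContDiff ℝ (⊤ : ℕ∞) φ) (hc : HasCompactSupport φ) (hs : tsupport φ ⊆ D.carrier) :
    Tendsto (fun δ : ℝ => ((δ ^ ((5:ℝ) / 3) : ℝ) : ℂ) * ∑ᶠ z : MedialVertex,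
        Summit.CriticalPhenomena.CardyFormulaZ2.Theorems.ParafermionPrecompact.Negative.F Λ δ z *
          ((fderiv ℝ φ (medialPoint δ z) 1 + Complex.I * fderiv ℝ φ (medialPoint δ z) Complex.I) / 2))
      (𝓝[>] 0) (𝓝 0) ↔
    Tendsto (fun δ : ℝ => ((δ ^ ((5:ℝ) / 3) : ℝ) : ℂ) * ∑ᶠ p : Site 2 × Fin 2,
        (fderiv ℝ φ (medialPoint δ (medialVertexOf p)) 1 -
            Complex.I * fderiv ℝ φ (medialPoint δ (medialVertexOf p)) Complex.I) / 2 *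
          (if p.2 = 0 then
              bondDartObservable (Λ δ) δ (1 / 3) (medialCornersAt p.1 p.2 1) +
                bondDartObservable (Λ δ) δ (1 / 3) (medialCornersAt p.1 p.2 3)
            else
              -(bondDartObservable (Λ δ) δ (1 / 3) (medialCornersAt p.1 p.2 0) +
                bondDartObservable (Λ δ) δ (1 / 3) (medialCornersAt p.1 p.2 2))))
      (𝓝[>] 0) (𝓝 0) :=
  (weakKirchhoff_tendsto_iff D Λ hΛ φ hφ hc hs).trans
    (staggeredArrival_tendsto_iff_weakKirchhoff Λ φ hφ hc (stub_staggeredFourDartFree Λ hΛ.2.2.2.2.2)).symm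

/-- **The crux IS the weak staggered arrival law.** `WeakHolomorphy` holds iff, along every admissible square-lattice
discretisation family of every Dobrushin domain and for every smooth test function compactly supported in the domain,
`δ^{5/3} · Σ_p ∂φ(z_p) · s_p · in_p → 0` as `δ → 0⁺`, where `in_p = F(c_{p,1}) + F(c_{p,3})` at a horizontal and
`F(c_{p,0}) + F(c_{p,2})` at a vertical medial vertex is the sum of the two ARRIVING spin-`1/3` dart observables
(`F = bondDartObservable (Λ δ) δ (1/3)`), `s_p = ±1` the sublattice sign and `∂φ = (∂_xφ − i∂_yφ)/2`: the `∂φ`-tested,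
h/v-staggered arrival phase observable of the percolation exploration is `o(δ^{1/3})` per vertex, weakly.
[cite: DuminilCopinSmirnov2012Lattice, Conjecture 8.7] -/
theorem weakHolomorphy_iff_staggeredArrival :
    Summit.CriticalPhenomena.CardyFormulaZ2.Theses.CardySusyWard.WeakHolomorphy ↔
    ∀ (D : DobrushinDomain) (Λ : ℝ → DiscreteDobrushin), IsFamily D Λ → ∀ (φ : ℂ → ℂ),
      ContDiff ℝ (⊤ : ℕ∞) φ → HasCompactSupport φ → tsupport φ ⊆ D.carrier →
        Tendsto (fun δ : ℝ => ((δ ^ ((5:ℝ) / 3) : ℝ) : ℂ) * ∑ᶠ p : Site 2 × Fin 2,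
            (fderiv ℝ φ (medialPoint δ (medialVertexOf p)) 1 -
                Complex.I * fderiv ℝ φ (medialPoint δ (medialVertexOf p)) Complex.I) / 2 *
              (if p.2 = 0 then
                  bondDartObservable (Λ δ) δ (1 / 3) (medialCornersAt p.1 p.2 1) +
                    bondDartObservable (Λ δ) δ (1 / 3) (medialCornersAt p.1 p.2 3)
                else
                  -(bondDartObservable (Λ δ) δ (1 / 3) (medialCornersAt p.1 p.2 0) +
                    bondDartObservable (Λ δ) δ (1 / 3) (medialCornersAt p.1 p.2 2))))
          (𝓝[>] 0) (𝓝 0) := by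
  rw [weakHolomorphy_iff_weakKirchhoff]
  constructor
  · intro h D Λ hΛ φ hφ hc hs
    exact (staggeredArrival_tendsto_iff_weakKirchhoff Λ φ hφ hc (stub_staggeredFourDartFree Λ hΛ.2.2.2.2.2)).2
      (h D Λ hΛ φ hφ hc hs)
  · intro h D Λ hΛ φ hφ hc hs
    exact (staggeredArrival_tendsto_iff_weakKirchhoff Λ φ hφ hc (stub_staggeredFourDartFree Λ hΛ.2.2.2.2.2)).1
      (h D Λ hΛ φ hφ hc hs)

/-- **The crux IS the weak staggered once-LEFT law.** `WeakHolomorphy` holds iff, along every admissible square-lattice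
discretisation family of every Dobrushin domain and for every smooth test function compactly supported in the domain,
`δ^{5/3} · Σ_p ∂φ(z_p) · s_p · Z_L(p) → 0` as `δ → 0⁺`, where
`Z_L(p) = onceChiralObs (Λ δ) δ (1/3) (medialVertexOf p) true = E[1{z_p visited exactly once, turning left} · e^{-iW_arrival/3}]`
is the once-visit LEFT chiral sum of the exploration at `z_p`, `s_p = ±1` the sublattice sign, `∂φ = (∂_xφ − i∂_yφ)/2`.
ONE chirality class of ONE visit-multiplicity class; no left/right comparison and no `e^{iπ/6}` datum are left in the statement of
what is open — the 30° chirality law of the record lives entirely in the FREE mode (`stub_staggeredFourDartFree`: weakly-staggered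
`A_L Z_L + A_R Z_R → 0`, `A_R = A_L e^{iπ/6}`). [cite: DuminilCopinSmirnov2012Lattice, Conjecture 8.7] -/
theorem weakHolomorphy_iff_staggeredOnceLeft :
    Summit.CriticalPhenomena.CardyFormulaZ2.Theses.CardySusyWard.WeakHolomorphy ↔
    ∀ (D : DobrushinDomain) (Λ : ℝ → DiscreteDobrushin), IsFamily D Λ → ∀ (φ : ℂ → ℂ),
      ContDiff ℝ (⊤ : ℕ∞) φ → HasCompactSupport φ → tsupport φ ⊆ D.carrier →
        Tendsto (fun δ : ℝ => ((δ ^ ((5:ℝ) / 3) : ℝ) : ℂ) * ∑ᶠ p : Site 2 × Fin 2,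
            (fderiv ℝ φ (medialPoint δ (medialVertexOf p)) 1 -
                Complex.I * fderiv ℝ φ (medialPoint δ (medialVertexOf p)) Complex.I) / 2 *
              ((if p.2 = 0 then (1 : ℂ) else -1) * onceChiralObs (Λ δ) δ (1 / 3) (medialVertexOf p) true))
          (𝓝[>] 0) (𝓝 0) := by
  rw [weakHolomorphy_iff_staggeredArrival]
  constructor
  · intro h D Λ hΛ φ hφ hc hs
    exact (staggeredOnceLeft_tendsto_iff_staggeredArrival D Λ hΛ φ hφ hc hs
      (stub_staggeredFourDartFree Λ hΛ.2.2.2.2.2)).2 (h D Λ hΛ φ hφ hc hs)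
  · intro h D Λ hΛ φ hφ hc hs
    exact (staggeredOnceLeft_tendsto_iff_staggeredArrival D Λ hΛ φ hφ hc hs
      (stub_staggeredFourDartFree Λ hΛ.2.2.2.2.2)).1 (h D Λ hΛ φ hφ hc hs)

/-- **Registered one-line form of `weakHolomorphy_iff_staggeredArrival`**: the crux `WeakHolomorphy` is EQUIVALENT to the
weak, `∂φ`-tested, sublattice-staggered arrival law of the spin-`1/3` dart observable. [cite: DuminilCopinSmirnov2012Lattice, Conjecture 8.7] -/
theorem stub_weakHolomorphyIffStaggeredArrival : Summit.CriticalPhenomena.CardyFormulaZ2.Theses.CardySusyWard.WeakHolomorphy ↔ ∀ (D : DobrushinDomain) (Λ : ℝ → DiscreteDobrushin), IsFamily D Λ → ∀ (φ : ℂ → ℂ), ContDiff ℝ (⊤ : ℕ∞) φ → HasCompactSupport φ → tsupport φ ⊆ D.carrier → Tendsto (fun δ : ℝ => ((δ ^ ((5:ℝ) / 3) : ℝ) : ℂ) * ∑ᶠ p : Site 2 × Fin 2, (fderiv ℝ φ (medialPoint δ (medialVertexOf p)) 1 - Complex.I * fderiv ℝ φ (medialPoint δ (medialVertexOf p)) Complex.I)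 / 2 * (if p.2 = 0 then bondDartObservable (Λ δ) δ (1 / 3) (medialCornersAt p.1 p.2 1) + bondDartObservable (Λ δ) δ (1 / 3) (medialCornersAt p.1 p.2 3) else -(bondDartObservable (Λ δ) δ (1 / 3) (medialCornersAt p.1 p.2 0) + bondDartObservable (Λ δ) δ (1 / 3) (medialCornersAt p.1 p.2 2)))) (𝓝[>] 0) (𝓝 0) :=
  weakHolomorphy_iff_staggeredArrival

/-- **Registered one-line form of `weakHolomorphy_iff_staggeredOnceLeft`**: the crux `WeakHolomorphy` is EQUIVALENT to the
weak, `∂φ`-tested, sublattice-staggered once-LEFT chiral law. [cite: DuminilCopinSmirnov2012Lattice, Conjecture 8.7] -/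
theorem stub_weakHolomorphyIffStaggeredOnceLeft : Summit.CriticalPhenomena.CardyFormulaZ2.Theses.CardySusyWard.WeakHolomorphy ↔ ∀ (D : DobrushinDomain) (Λ : ℝ → DiscreteDobrushin), IsFamily D Λ → ∀ (φ : ℂ → ℂ), ContDiff ℝ (⊤ : ℕ∞) φ → HasCompactSupport φ → tsupport φ ⊆ D.carrier → Tendsto (fun δ : ℝ => ((δ ^ ((5:ℝ) / 3) : ℝ) : ℂ) * ∑ᶠ p : Site 2 × Fin 2, (fderiv ℝ φ (medialPoint δ (medialVertexOf p)) 1 - Complex.I * fderiv ℝ φ (medialPoint δ (medialVertexOf p)) Complex.I) / 2 * ((if p.2 = 0 then (1 : ℂ) else -1) * onceChiralObs (Λ δ) δ (1 / 3) (medialVertexOf p) true)) (𝓝[>] 0) (𝓝 0) :=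
  weakHolomorphy_iff_staggeredOnceLeft

end Summit.CriticalPhenomena.CardyFormulaZ2.Theorems.WeakHolomorphy.SplitBypass

end
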